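import Summits.SmoothPoincare4.SmoothPoincare4.Theorems.CongruenceShadowsHeegaardHandlebodyCongruenceClosedStubLimitsSimplyConnectedHelpers
import Literature.GroupTheory.CombinatorialGroupTheory.FreeGroupResiduallyFinite

/-!
# Closedness of the standard handlebody kernels; frozen-factor limits are simply connected — crux
`CongruenceShadows.HeegaardHandlebodyCongruenceClosed` (item stmt-SmoothPoincare4-14596), line `pair-rigidity-retraction`,
helper toward the OPEN stub P3 `stub_limitsSimplyConnected`

Notation: `S = S_{3+3m} = SurfaceGroup (3+3m)`, `N = (N₀,N₁,N₂) = s4Kernels.stabilizeIter m`, `H = Stab N₀ ∩ Stab N₁`,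
`C = Stab N₂ ≤ Aut S`, `T_ρ = N₀ ⊔ N₁ ⊔ ρN₂`.

* `closed_of_isFreeOfRank_quotient` — a normal subgroup `K ≤ S_g` with FREE quotient `S_g ⧸ K ≅ F_n` is CLOSED in the
  characteristic profinite topology of `S_g`: `⋂_{M char., f.i.} K·M = K`.  Proof: free groups are residually finite
  (`Literature.GroupTheory.CombinatorialGroupTheory.exists_finiteIndex_normal_notMem`, landed for this purpose) and
  characteristic finite-index subgroups are cofinal (`exists_characteristic_le`).
* `closed_stabilizeIter` — in particular each standard kernel `N_i` is closed (`S ⧸ N_i ≅ F_{3+3m}`).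
* Hence the landed CONDITIONAL partial results of `…StubLimitsSimplyConnectedHelpers.lean` become unconditional:
  `tripleJoin_eq_top_of_frozenLeft/Right`, `tripleJoin_eq_top_of_finiteLeft/Right` — if, along the tower of
  characteristic levels, one of the two factor sequences `x_M ∈ H` / `c_M ∈ C` of a product-congruent `ρ` can be frozen
  (or confined to a finite set), then `T_ρ = ⊤` (the glued 4-manifold is simply connected).  So a counterexample to P3
  needs BOTH factor sequences to leave every finite subset of `H`, `C`.
* `stub_limitsSimplyConnectedFrozenFactor` — the registered helper stub (frozen left factor, verbatim signature).
-/

noncomputable section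

-- the prescribed namespace `Summit.<P>.<Sub>.…` duplicates `SmoothPoincare4` (P = Sub)
set_option linter.dupNamespace false

namespace Summit.SmoothPoincare4.SmoothPoincare4.Theorems.HeegaardHandlebodyCongruenceClosed.PairRigidityRetraction

open Literature.Topology.FourManifolds Subgroup
open Summit.SmoothPoincare4.SmoothPoincare4.Theorems.WaldhausenPairs.Negative (stabilizeIter_isGroupTrisection)
open Literature.GroupTheory.CombinatorialGroupTheory (exists_finiteIndex_normal_notMem)

/-! ## Closedness of kernels with free quotient -/

/-- **Kernels with free quotient are closed in the characteristic profinite topology.**  Let `K ⊴ S_g` with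
`S_g ⧸ K ≅ F_n`.  If `s ∈ K ⊔ M` for every characteristic finite-index `M ≤ S_g`, then `s ∈ K`.  (Residual
finiteness of `F_n`: a non-trivial image `s̄ ∈ S_g ⧸ K` misses some finite-index normal subgroup, whose preimage in
`S_g` contains a characteristic finite-index `M` by cofinality — and then `K ⊔ M` misses `s`.) [folklore] -/
theorem closed_of_isFreeOfRank_quotient {g n : ℕ} (K : Subgroup (SurfaceGroup g)) [K.Normal]
    (hK : IsFreeOfRank (SurfaceGroup g ⧸ K) n) (s : SurfaceGroup g)
    (hs : ∀ M : Subgroup (SurfaceGroup g), M.Characteristic → M.FiniteIndex → s ∈ K ⊔ M) : s ∈ K := by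
  by_contra hsK
  obtain ⟨e⟩ := hK
  -- the image of `s` in the free group is non-trivial
  set q : SurfaceGroup g →* SurfaceGroup g ⧸ K := QuotientGroup.mk' K with hq
  have hqs : q s ≠ 1 := fun h1 => hsK ((QuotientGroup.eq_one_iff s).1 h1)
  have hx : e.symm (q s) ≠ 1 := fun h1 => hqs (by simpa using congrArg e h1)
  -- residual finiteness of the free group
  obtain ⟨L, hLn, hLf, hxL⟩ := exists_finiteIndex_normal_notMem (e.symm (q s)) hx
  haveI := hLn
  haveI := hLf
  -- pull `L` back to `S_g ⧸ K`, then to `S_g`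
  haveI hL'f : (L.comap e.symm.toMonoidHom).FiniteIndex := by
    refine ⟨fun h0 => hLf.index_ne_zero ?_⟩
    rw [← Subgroup.index_comap_of_surjective (H := L) (f := e.symm.toMonoidHom) e.symm.surjective]
    exact h0
  have hqsurj : Function.Surjective q := QuotientGroup.mk'_surjective K
  haveI hPf : ((L.comap e.symm.toMonoidHom).comap q).FiniteIndex := by
    refine ⟨fun h0 => hL'f.index_ne_zero ?_⟩
    rw [← Subgroup.index_comap_of_surjective (H := L.comap e.symm.toMonoidHom) (f := q) hqsurj]
    exact h0
  have hsP : s ∉ (L.comap e.symm.toMonoidHom).comap q := fun h => hxL h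
  have hKP : K ≤ (L.comap e.symm.toMonoidHom).comap q := fun k hk => by
    have hqk : q k = 1 := by
      rw [hq, QuotientGroup.mk'_apply]
      exact (QuotientGroup.eq_one_iff k).2 hk
    show e.symm.toMonoidHom (q k) ∈ L
    rw [hqk, map_one]
    exact one_mem L
  -- a characteristic finite-index `M` inside the pulled-back subgroup
  obtain ⟨M, hMc, hMf, hMP⟩ := exists_characteristic_le ((L.comap e.symm.toMonoidHom).comap q)
  exact hsP (sup_le hKP hMP (hs M hMc hMf))

/-- **The standard handlebody kernels are closed**: for every `m`, `i` and `s ∈ S_{3+3m}`, if `s ∈ N_i ⊔ M` for every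
characteristic finite-index `M`, then `s ∈ N_i` (`S ⧸ N_i ≅ F_{3+3m}` is residually finite). [folklore] -/
theorem closed_stabilizeIter (m : ℕ) (i : Fin 3) (s : SurfaceGroup (3 + 3 * m))
    (hs : ∀ M : Subgroup (SurfaceGroup (3 + 3 * m)), M.Characteristic → M.FiniteIndex →
      s ∈ s4Kernels.stabilizeIter m i ⊔ M) : s ∈ s4Kernels.stabilizeIter m i := by
  haveI : (s4Kernels.stabilizeIter m i).Normal := stabilizeIter_normal m i
  have hfree : IsFreeOfRank (SurfaceGroup (3 + 3 * m) ⧸ s4Kernels.stabilizeIter m i) (3 + 3 * m) :=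
    ((stabilizeIter_isGroupTrisection m).free_quotient i).of_mulEquiv
      (QuotientGroup.quotientMulEquivOfEq (normalClosure_eq_self _))
  exact closed_of_isFreeOfRank_quotient _ hfree s hs

/-! ## Frozen or finitely-confined factor sequences glue simply connected 4-manifolds (unconditional) -/

/-- **Frozen left factor.** If ONE `x ∈ H` serves at every characteristic finite-index level (`ρ ≡ x ∘ c_M (mod M)` with
`c_M ∈ C`), then `N₀ ⊔ N₁ ⊔ ρN₂ = ⊤`. [folklore] -/
theorem tripleJoin_eq_top_of_frozenLeft {m : ℕ} {ρ : SurfaceGroup (3 + 3 * m) ≃* SurfaceGroup (3 + 3 * m)}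
    (x : SurfaceGroup (3 + 3 * m) ≃* SurfaceGroup (3 + 3 * m))
    (hx0 : (s4Kernels.stabilizeIter m 0).map x.toMonoidHom = s4Kernels.stabilizeIter m 0)
    (hx1 : (s4Kernels.stabilizeIter m 1).map x.toMonoidHom = s4Kernels.stabilizeIter m 1)
    (h : ∀ M : Subgroup (SurfaceGroup (3 + 3 * m)), M.Characteristic → M.FiniteIndex →
      ∃ c : SurfaceGroup (3 + 3 * m) ≃* SurfaceGroup (3 + 3 * m),
        (s4Kernels.stabilizeIter m 2).map c.toMonoidHom = s4Kernels.stabilizeIter m 2 ∧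
        ∀ s, ρ s * (x (c s))⁻¹ ∈ M) :
    s4Kernels.stabilizeIter m 0 ⊔ s4Kernels.stabilizeIter m 1 ⊔
      (s4Kernels.stabilizeIter m 2).map ρ.toMonoidHom = ⊤ :=
  p3_tripleJoin_eq_top_of_frozenLeft (closed_stabilizeIter m 2) x hx0 hx1 h

/-- **Frozen right factor.** If ONE `c ∈ C` serves at every characteristic finite-index level (`ρ ≡ x_M ∘ c (mod M)`
with `x_M ∈ H`), then `N₀ ⊔ N₁ ⊔ ρN₂ = ⊤`. [folklore] -/
theorem tripleJoin_eq_top_of_frozenRight {m : ℕ} {ρ : SurfaceGroup (3 + 3 * m) ≃* SurfaceGroup (3 + 3 * m)}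
    (c : SurfaceGroup (3 + 3 * m) ≃* SurfaceGroup (3 + 3 * m))
    (hc : (s4Kernels.stabilizeIter m 2).map c.toMonoidHom = s4Kernels.stabilizeIter m 2)
    (h : ∀ M : Subgroup (SurfaceGroup (3 + 3 * m)), M.Characteristic → M.FiniteIndex →
      ∃ x : SurfaceGroup (3 + 3 * m) ≃* SurfaceGroup (3 + 3 * m),
        (s4Kernels.stabilizeIter m 0).map x.toMonoidHom = s4Kernels.stabilizeIter m 0 ∧
        (s4Kernels.stabilizeIter m 1).map x.toMonoidHom = s4Kernels.stabilizeIter m 1 ∧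
        ∀ s, ρ s * (x (c s))⁻¹ ∈ M) :
    s4Kernels.stabilizeIter m 0 ⊔ s4Kernels.stabilizeIter m 1 ⊔
      (s4Kernels.stabilizeIter m 2).map ρ.toMonoidHom = ⊤ :=
  p3_tripleJoin_eq_top_of_frozenRight (closed_stabilizeIter m 0) (closed_stabilizeIter m 1) c hc h

/-- **Finitely many left factors.** If the left factors `x_M ∈ H` of a product-congruent `ρ` can be chosen in a FINITE
family, then `N₀ ⊔ N₁ ⊔ ρN₂ = ⊤`. [folklore] -/
theorem tripleJoin_eq_top_of_finiteLeft {m : ℕ} {ρ : SurfaceGroup (3 + 3 * m) ≃* SurfaceGroup (3 + 3 * m)}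
    {ι : Type*} [Finite ι] (xs : ι → SurfaceGroup (3 + 3 * m) ≃* SurfaceGroup (3 + 3 * m))
    (hx0 : ∀ i, (s4Kernels.stabilizeIter m 0).map (xs i).toMonoidHom = s4Kernels.stabilizeIter m 0)
    (hx1 : ∀ i, (s4Kernels.stabilizeIter m 1).map (xs i).toMonoidHom = s4Kernels.stabilizeIter m 1)
    (h : ∀ M : Subgroup (SurfaceGroup (3 + 3 * m)), M.Characteristic → M.FiniteIndex →
      ∃ i, ∃ c : SurfaceGroup (3 + 3 * m) ≃* SurfaceGroup (3 + 3 * m),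
        (s4Kernels.stabilizeIter m 2).map c.toMonoidHom = s4Kernels.stabilizeIter m 2 ∧
        ∀ s, ρ s * (xs i (c s))⁻¹ ∈ M) :
    s4Kernels.stabilizeIter m 0 ⊔ s4Kernels.stabilizeIter m 1 ⊔
      (s4Kernels.stabilizeIter m 2).map ρ.toMonoidHom = ⊤ :=
  p3_tripleJoin_eq_top_of_finiteLeft (closed_stabilizeIter m 2) xs hx0 hx1 h

/-- **Finitely many right factors.** If the right factors `c_M ∈ C` of a product-congruent `ρ` can be chosen in a
FINITE family, then `N₀ ⊔ N₁ ⊔ ρN₂ = ⊤`. [folklore] -/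
theorem tripleJoin_eq_top_of_finiteRight {m : ℕ} {ρ : SurfaceGroup (3 + 3 * m) ≃* SurfaceGroup (3 + 3 * m)}
    {ι : Type*} [Finite ι] (cs : ι → SurfaceGroup (3 + 3 * m) ≃* SurfaceGroup (3 + 3 * m))
    (hc : ∀ i, (s4Kernels.stabilizeIter m 2).map (cs i).toMonoidHom = s4Kernels.stabilizeIter m 2)
    (h : ∀ M : Subgroup (SurfaceGroup (3 + 3 * m)), M.Characteristic → M.FiniteIndex →
      ∃ i, ∃ x : SurfaceGroup (3 + 3 * m) ≃* SurfaceGroup (3 + 3 * m),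
        (s4Kernels.stabilizeIter m 0).map x.toMonoidHom = s4Kernels.stabilizeIter m 0 ∧
        (s4Kernels.stabilizeIter m 1).map x.toMonoidHom = s4Kernels.stabilizeIter m 1 ∧
        ∀ s, ρ s * (x (cs i s))⁻¹ ∈ M) :
    s4Kernels.stabilizeIter m 0 ⊔ s4Kernels.stabilizeIter m 1 ⊔
      (s4Kernels.stabilizeIter m 2).map ρ.toMonoidHom = ⊤ :=
  p3_tripleJoin_eq_top_of_finiteRight (closed_stabilizeIter m 0) (closed_stabilizeIter m 1) cs hc h

/-! ## The registered helper stub -/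

/-- **Registered stub `stub_limitsSimplyConnectedFrozenFactor` of line `pair-rigidity-retraction`** (helper toward the
OPEN stub P3 `stub_limitsSimplyConnected`; signature verbatim as registered on stmt-SmoothPoincare4-14596): a
product-congruent `ρ` whose LEFT factor can be frozen (`ρ ≡ x ∘ c_M (mod M)` for one `x ∈ Stab N₀ ∩ Stab N₁` and all
characteristic finite-index `M`) glues a simply connected 4-manifold: `N₀ ⊔ N₁ ⊔ ρN₂ = ⊤`, at every genus,
unconditionally. `= tripleJoin_eq_top_of_frozenLeft`. [folklore] -/
theorem stub_limitsSimplyConnectedFrozenFactor :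
    ∀ (m : ℕ) (ρ x : SurfaceGroup (3 + 3 * m) ≃* SurfaceGroup (3 + 3 * m)),
      (s4Kernels.stabilizeIter m 0).map x.toMonoidHom = s4Kernels.stabilizeIter m 0 →
      (s4Kernels.stabilizeIter m 1).map x.toMonoidHom = s4Kernels.stabilizeIter m 1 →
      (∀ M : Subgroup (SurfaceGroup (3 + 3 * m)), M.Characteristic → M.FiniteIndex →
        ∃ c : SurfaceGroup (3 + 3 * m) ≃* SurfaceGroup (3 + 3 * m),
          (s4Kernels.stabilizeIter m 2).map c.toMonoidHom = s4Kernels.stabilizeIter m 2 ∧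
          ∀ s, ρ s * (x (c s))⁻¹ ∈ M) →
      s4Kernels.stabilizeIter m 0 ⊔ s4Kernels.stabilizeIter m 1 ⊔
        (s4Kernels.stabilizeIter m 2).map ρ.toMonoidHom = ⊤ :=
  fun _ _ x hx0 hx1 h => tripleJoin_eq_top_of_frozenLeft x hx0 hx1 h

end Summit.SmoothPoincare4.SmoothPoincare4.Theorems.HeegaardHandlebodyCongruenceClosed.PairRigidityRetraction

end
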